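import Literature.Topology.FourManifolds.SmaleHomologySpheresDouble
import Literature.Topology.FourManifolds.SmaleHomologySpheresPropAHCobordism
import Literature.Topology.FourManifolds.HCobordismOneLeaf
import Literature.Topology.FourManifolds.HCobordismSlideStepSign
import HarnessLib

/-!
# Discharged facts: smooth homology spheres of dimension `≥ 5` are topological spheres (Smale 1961;
# Milnor 1965, §9 Prop. B) and Milnor's Prop. A, from the h-cobordism theorem

Two named facts of `Topology/FourManifolds/SmaleHomologySpheres*` were reduced in the tree to the
h-cobordism theorem at universe `0` (`isTrivial_of_isHCobordism_of_five_le.{0}`, Milnor 1965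
Thm. 9.1) by `nonempty_homeomorph_sphere_of_homologySphere_of_five_le_of_hcobordism_theorem`
(`SmaleHomologySpheresDouble`) and `Milnor1965_propA_of_hcobordism_univ`
(`SmaleHomologySpheresPropAHCobordism`), whose docstrings announce the unconditional `…_holds` "when
that lands".  The h-cobordism theorem is now closed: its last leaf, the Basis Theorem 7.6 on a slab,
is the theorem `Cobordism.Milnor1965_basisTheorem_slab_holds` (`HCobordismSlideStepSign`), and
`isTrivial_of_isHCobordism_of_five_le_holds_of` (`HCobordismOneLeaf`) turns it into Thm. 9.1 (the
named discharge `isTrivial_of_isHCobordism_of_five_le_holds` lives in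
`HCobordismTheoremHoldsProofs`; here the same term is inlined so that this file depends only on
long-built modules).  One-line applications; no statement is changed; no definition, no new named
fact (D-0026); net Literature debt **−2**.

* `nonempty_homeomorph_sphere_of_homologySphere_of_five_le_holds` — **every closed simply connected
  smooth integral homology `n`-sphere, `n ≥ 5`, is homeomorphic to `Sⁿ`** (Smale 1961; Milnor 1965,
  §9 Prop. B: Kervaire–Milnor Lemma 2.4, Prop. A via Thm. 9.1, Brown's Schoenflies theorem and the
  Alexander trick — all proved in the tree);
* `Milnor1965_propA_holds` — **Milnor 1965, §9 Prop. A** (`4) ⇒ 1)`): a compact contractible smooth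
  manifold of dimension `≥ 6` with simply connected boundary is diffeomorphic to the disc.

## References

* J. Milnor, *Lectures on the h-cobordism theorem* (1965), §9: Thm. 9.1 (p. 107), Prop. A and its
  proof (pp. 108–109), Prop. B (p. 109). [MilnorHCobordism1965]
* S. Smale, *Generalized Poincaré's conjecture in dimensions greater than four*, Ann. of Math. 74
  (1961) 391–406.
-/

noncomputable section

namespace Literature.Topology.FourManifolds

universe u

/-- **Smale 1961 / Milnor 1965 §9 Prop. B: a closed simply connected smooth homology `n`-sphere,
`n ≥ 5`, is homeomorphic to `Sⁿ` — the named fact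
`nonempty_homeomorph_sphere_of_homologySphere_of_five_le` holds**
(`nonempty_homeomorph_sphere_of_homologySphere_of_five_le_of_hcobordism_theorem` applied to the
h-cobordism theorem `isTrivial_of_isHCobordism_of_five_le_holds_of Cobordism.Milnor1965_basisTheorem_slab_holds`).
[cite: MilnorHCobordism1965, §9, Prop. B (p. 109) and Thm. 9.1 (p. 107)] -/
theorem nonempty_homeomorph_sphere_of_homologySphere_of_five_le_holds :
    nonempty_homeomorph_sphere_of_homologySphere_of_five_le.{u} :=
  nonempty_homeomorph_sphere_of_homologySphere_of_five_le_of_hcobordism_theorem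
    (isTrivial_of_isHCobordism_of_five_le_holds_of Cobordism.Milnor1965_basisTheorem_slab_holds)

/-- **Milnor 1965, §9 Prop. A (`4) ⇒ 1)`) — the named fact `Milnor1965_propA` holds**
(`Milnor1965_propA_of_hcobordism_univ` applied to the h-cobordism theorem).
[cite: MilnorHCobordism1965, §9 Thm. 9.1, Prop. A and its proof (pp. 107–109; PDF pp. 57–58)] -/
theorem Milnor1965_propA_holds : Milnor1965_propA.{u} :=
  Milnor1965_propA_of_hcobordism_univ
    (isTrivial_of_isHCobordism_of_five_le_holds_of Cobordism.Milnor1965_basisTheorem_slab_holds)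

end Literature.Topology.FourManifolds

end
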